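import Literature.Computability.Cryptography.ChenQuantumLWEReadoutClass
import Literature.Computability.Cryptography.ChenQuantumLWEDatumOptimum

/-!
# Chen's Step 8 read-out constant is the Step-9 datum value: `pairsCountT(Q,T)/Q^{2n} = V(Q, #T)` (Part 1 = Part 2)

REPRODUCTION / ANALYSIS OF A CLAIMED RESULT UNDER ADJUDICATION (withdrawn): Yilei Chen, *Quantum
Algorithms for Lattice Problems*, IACR ePrint 2024/555, version of 2024-04-18 [ChenQuantumLattice2024]
(the version carrying the author's note that Step 9 contains a bug), Steps 8–9 (§3.5.8–§3.5.9,
pp. 34–38).  Bundle `papers/QuantumAdvantage/lwe-quantum-autopsy/`: this module is the BRIDGE between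
Part 1 (modules (S) `ChenQuantumLWEReadoutOrder`, (T) `…ReadoutAttained`, (U) `…ReadoutClass`,
(V) `…ReadoutJoint`: the minimax probability of reading the Step-9 datum off the Step-8 register
`|φ7.d⟩` on the class `InClass U` is the constant `pairsCountT(Q, T_U)/Q^{2n}`) and Part 2 (module
`ChenQuantumLWEDatumOptimum`, census theorem T13: the optimum of the datum read-out of the Step-9
register is the value `datumValue Q ι = V(Q, #ι) = Q^{-#ι}·Σ_β 1/#span(β)`).
HONEST FRAMING: kernel-checked elementary counting identifying two already formalised EXACT VALUES of
information quantities of registers of a WITHDRAWN algorithm — a decidable verdict sharpening a precise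
NEGATIVE result; NOT summit progress, no cryptanalytic claim in either direction, no new algorithm for
any lattice problem.

## What is proved

* `mul_kerCountT_eq`: `Q·#{δ ∈ ℤ_Qⁿ : Σ_{t∈T} η_tδ_t = 0} = Qⁿ·#{σ ∈ ℤ_Q : ση_t = 0 ∀ t ∈ T}` — T13's
  duality `#span·#ker = Q^{n}`, `#span·#ann = Q` (`card_span_mul_card_ker`, `card_span_mul_card_ann`)
  applied to the truncation of `η` to `T`;
* `card_annVec_eq`, `sum_card_annT_eq`: `Σ_η #{σ : ση_T = 0} = Q^{n−#T}·Σ_σ #{x : σx = 0}^{#T}`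
  (double counting the pairs `(η, σ)`);
* `mul_pairsCountT_eq_sum_pow`: `Q·pairsCountT(Q,T) = Qⁿ·Q^{n−#T}·Σ_{σ ∈ ℤ_Q} #{x : σx = 0}^{#T}` — the
  composite-`Q` closed form of Part 1's constant left open in (S)/(T) (there: prime `Q` only,
  `pairsCountT_div_eq_prime`);
* `pairsCountT_div_eq_sum_pow`, **`pairsCountT_div_eq_datumValue`**:
  `pairsCountT(Q,T)/Q^{2n} = Q^{-(#T+1)}·Σ_σ #{x : σx = 0}^{#T} = datumValue Q ι` for every index type with
  `#ι = #T` (T13's `datumValue_eq_sum_pow`); with `ChenQuantumLWEDatumValueClosedForm`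
  (`datumValue_eq_sum_gcd_pow`, `datumValue_eq_sum_divisors`) this is
  `Q^{-(#T+1)}·Σ_σ gcd(Q,σ)^{#T} = Q^{-(#T+1)}·Σ_{d∣Q} φ(Q/d)·d^{#T}`;
* `Shape.readoutConst_eq_datumValue`, **`Shape.step9Needs_readout_value_class_datumValue`**: (U)'s
  minimax read-out value of the Step-9 datum on the class `InClass U`, restated: it is Part 2's value
  `V(Q, #T_U)` (`T_U = {t : t+1 ∈ U}` the dummies obstructing the read-out); the same rewrite applies
  verbatim to (V)'s several-copies value `Shape.step9Needs_readout_value_joint`.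

So ONE function `V(Q, m) = Q^{-(m+1)}·Σ_{σ∈ℤ_Q} gcd(Q,σ)^m` (`= 1/Q + (1 − 1/Q)/Q^m` for prime `Q`) governs
both interfaces of the withdrawn Step 9: the privacy of the datum inside the Step-9 register (Part 2,
`m = #U`) and the read-out of the datum from the Step-8 register (Part 1, `m = #T_U`).

## Declarations used, not re-proved
(S) `kerCountT`, `pairsCountT`, `pairsCountT_eq_sum_kerCountT`; (U) `Shape.step9Needs_readout_value_class`,
`Shape.tailSet`, `Shape.classPOVM`, `Shape.classDec`; Part 2 T13 `span`, `card_span_mul_card_ker`,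
`card_span_mul_card_ann`, `datumValue`, `datumValue_eq_sum_pow`.
-/

namespace Literature.Computability.Cryptography.Chen2024

open scoped BigOperators
open Matrix

/-! ### 1. Counting: kernels of `T`-supported linear forms, annihilators, the closed form -/

section Counting

variable (Q : ℕ+) {n : ℕ}

/-- Truncation of `η ∈ ℤ_Qⁿ` to the coordinates in `T` (zero elsewhere). [folklore] -/
def truncOn (T : Finset (Fin n)) (η : Fin n → ZQ Q) : Fin n → ZQ Q := fun i => if i ∈ T then η i else 0

/-- `Σ_i c_i·(η|_T)_i = Σ_{t ∈ T} η_t c_t`. [folklore] -/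
theorem sum_mul_truncOn (T : Finset (Fin n)) (η c : Fin n → ZQ Q) :
    ∑ i, c i * truncOn Q T η i = ∑ t ∈ T, η t * c t := by
  simp only [truncOn, mul_ite, mul_zero]
  rw [Finset.sum_ite_mem, Finset.univ_inter]
  exact Finset.sum_congr rfl fun t _ => mul_comm _ _

/-- `kerCountT Q T η` is the kernel count of the linear form of the truncation `η|_T`. [folklore] -/
theorem kerCountT_eq_card_ker (T : Finset (Fin n)) (η : Fin n → ZQ Q) :
    kerCountT (Q : ℕ) T η = Nat.card {c : Fin n → ZQ Q // ∑ i, c i * truncOn Q T η i = 0} := by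
  unfold kerCountT
  rw [Nat.card_eq_fintype_card, Fintype.card_subtype]
  congr 1
  ext δ
  simp only [Finset.mem_filter, Finset.mem_univ, true_and, sum_mul_truncOn]

/-- The annihilator of the truncation is `{σ : ση_t = 0 ∀ t ∈ T}`. [folklore] -/
theorem card_ann_truncOn (T : Finset (Fin n)) (η : Fin n → ZQ Q) :
    Nat.card {σ : ZQ Q // ∀ i, σ * truncOn Q T η i = 0} = Nat.card {σ : ZQ Q // ∀ t ∈ T, σ * η t = 0} := by
  refine Nat.card_congr (Equiv.subtypeEquivRight fun σ => ⟨fun h t ht => ?_, fun h i => ?_⟩)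
  · have := h t
    simp only [truncOn, if_pos ht] at this
    exact this
  · by_cases hi : i ∈ T
    · simp only [truncOn, if_pos hi]
      exact h i hi
    · simp only [truncOn, if_neg hi, mul_zero]

/-- **`Q·#ker_T(η) = Qⁿ·#ann_T(η)`**: `Q·#{δ : Σ_{t∈T} η_tδ_t = 0} = Qⁿ·#{σ : ση_t = 0 ∀ t ∈ T}` — T13's
duality (`#span·#ker = Qⁿ`, `#span·#ann = Q`) for the truncation `η|_T`. [folklore] -/
theorem mul_kerCountT_eq (T : Finset (Fin n)) (η : Fin n → ZQ Q) :
    ((Q : ℕ+) : ℕ) * kerCountT (Q : ℕ) T η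
      = ((Q : ℕ+) : ℕ) ^ n * Nat.card {σ : ZQ Q // ∀ t ∈ T, σ * η t = 0} := by
  have hK := card_span_mul_card_ker Q (truncOn Q T η)
  have hA := card_span_mul_card_ann Q (truncOn Q T η)
  rw [Fintype.card_fin, ← kerCountT_eq_card_ker] at hK
  rw [card_ann_truncOn] at hA
  calc ((Q : ℕ+) : ℕ) * kerCountT (Q : ℕ) T η
      = Nat.card (span Q (truncOn Q T η)) * Nat.card {σ : ZQ Q // ∀ t ∈ T, σ * η t = 0}
          * kerCountT (Q : ℕ) T η := by rw [hA]
    _ = Nat.card (span Q (truncOn Q T η)) * kerCountT (Q : ℕ) T η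
          * Nat.card {σ : ZQ Q // ∀ t ∈ T, σ * η t = 0} := by ring
    _ = ((Q : ℕ+) : ℕ) ^ n * Nat.card {σ : ZQ Q // ∀ t ∈ T, σ * η t = 0} := by rw [hK]

/-- `#{η ∈ ℤ_Qⁿ : ση_t = 0 ∀ t ∈ T} = #{x : σx = 0}^{#T}·Q^{n−#T}` (coordinates outside `T` are free).
[folklore] -/
theorem card_annVec_eq (T : Finset (Fin n)) (σ : ZQ Q) :
    Nat.card {η : Fin n → ZQ Q // ∀ t ∈ T, σ * η t = 0}
      = Nat.card {x : ZQ Q // σ * x = 0} ^ T.card * ((Q : ℕ+) : ℕ) ^ (n - T.card) := by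
  rw [Nat.card_congr (@Equiv.subtypePiEquivPi (Fin n) (fun _ => ZQ Q) (fun i x => i ∈ T → σ * x = 0)),
    Nat.card_pi]
  have hc : ∀ i : Fin n, Nat.card {x : ZQ Q // i ∈ T → σ * x = 0}
      = if i ∈ T then Nat.card {x : ZQ Q // σ * x = 0} else ((Q : ℕ+) : ℕ) := by
    intro i
    split_ifs with hi
    · exact Nat.card_congr (Equiv.subtypeEquivRight fun x => ⟨fun h => h hi, fun h _ => h⟩)
    · rw [Nat.card_congr (Equiv.subtypeUnivEquiv fun (x : ZQ Q) (h : i ∈ T) => absurd h hi),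
        Nat.card_eq_fintype_card, ZMod.card]
  have h1 : (Finset.univ.filter fun i : Fin n => i ∈ T).card = T.card := by
    rw [Finset.filter_mem_eq_inter, Finset.univ_inter]
  have h2 : (Finset.univ.filter fun i : Fin n => ¬ i ∈ T).card = n - T.card := by
    have : (Finset.univ.filter fun i : Fin n => ¬ i ∈ T) = Tᶜ := by
      ext i
      simp only [Finset.mem_filter, Finset.mem_univ, true_and, Finset.mem_compl]
    rw [this, Finset.card_compl, Fintype.card_fin]
  rw [Finset.prod_congr rfl fun i _ => hc i, Finset.prod_ite, Finset.prod_const, Finset.prod_const, h1, h2]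

/-- **Double counting**: `Σ_η #{σ : ση_t = 0 ∀ t ∈ T} = Q^{n−#T}·Σ_σ #{x : σx = 0}^{#T}`. [folklore] -/
theorem sum_card_annT_eq (T : Finset (Fin n)) :
    ∑ η : Fin n → ZQ Q, Nat.card {σ : ZQ Q // ∀ t ∈ T, σ * η t = 0}
      = ((Q : ℕ+) : ℕ) ^ (n - T.card) * ∑ σ : ZQ Q, Nat.card {x : ZQ Q // σ * x = 0} ^ T.card := by
  have h1 : ∀ η : Fin n → ZQ Q, Nat.card {σ : ZQ Q // ∀ t ∈ T, σ * η t = 0}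
      = ∑ σ : ZQ Q, if ∀ t ∈ T, σ * η t = 0 then 1 else 0 := by
    intro η
    rw [Finset.sum_boole, Nat.cast_id, Nat.card_eq_fintype_card, Fintype.card_subtype]
  have h2 : ∀ σ : ZQ Q, (∑ η : Fin n → ZQ Q, if ∀ t ∈ T, σ * η t = 0 then 1 else 0)
      = Nat.card {η : Fin n → ZQ Q // ∀ t ∈ T, σ * η t = 0} := by
    intro σ
    rw [Finset.sum_boole, Nat.cast_id, Nat.card_eq_fintype_card, Fintype.card_subtype]
  rw [Finset.sum_congr rfl fun η _ => h1 η, Finset.sum_comm, Finset.sum_congr rfl fun σ _ => h2 σ,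
    Finset.sum_congr rfl fun σ _ => card_annVec_eq Q T σ, ← Finset.sum_mul, mul_comm]

/-- **Part 1's constant in closed form, every `Q`**:
`Q·pairsCountT(Q,T) = Qⁿ·Q^{n−#T}·Σ_{σ ∈ ℤ_Q} #{x ∈ ℤ_Q : σx = 0}^{#T}` (`#{x : σx = 0} = gcd(Q, σ)`).
[folklore] -/
theorem mul_pairsCountT_eq_sum_pow (T : Finset (Fin n)) :
    ((Q : ℕ+) : ℕ) * pairsCountT (Q : ℕ) T
      = ((Q : ℕ+) : ℕ) ^ n * ((Q : ℕ+) : ℕ) ^ (n - T.card)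
          * ∑ σ : ZQ Q, Nat.card {x : ZQ Q // σ * x = 0} ^ T.card := by
  rw [pairsCountT_eq_sum_kerCountT, Finset.mul_sum, Finset.sum_congr rfl fun η _ => mul_kerCountT_eq Q T η,
    ← Finset.mul_sum, sum_card_annT_eq, mul_assoc]

/-- **The read-out constant as one sum over `ℤ_Q`**:
`pairsCountT(Q,T)/Q^{2n} = Q^{-(#T+1)}·Σ_{σ ∈ ℤ_Q} #{x : σx = 0}^{#T}`. [folklore] -/
theorem pairsCountT_div_eq_sum_pow (T : Finset (Fin n)) :
    (pairsCountT (Q : ℕ) T : ℝ) / (((Q : ℕ+) : ℕ) : ℝ) ^ (2 * n)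
      = (∑ σ : ZQ Q, ((Nat.card {x : ZQ Q // σ * x = 0} : ℝ)) ^ T.card)
          / (((Q : ℕ+) : ℕ) : ℝ) ^ (T.card + 1) := by
  have hQ : (0 : ℝ) < ((Q : ℕ+) : ℕ) := by exact_mod_cast PNat.pos Q
  have hT : T.card ≤ n := by simpa using Finset.card_le_univ T
  have hreal : (((Q : ℕ+) : ℕ) : ℝ) * (pairsCountT (Q : ℕ) T : ℝ)
      = (((Q : ℕ+) : ℕ) : ℝ) ^ n * (((Q : ℕ+) : ℕ) : ℝ) ^ (n - T.card)
          * ∑ σ : ZQ Q, ((Nat.card {x : ZQ Q // σ * x = 0} : ℝ)) ^ T.card := by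
    exact_mod_cast mul_pairsCountT_eq_sum_pow Q T
  have hpow : (((Q : ℕ+) : ℕ) : ℝ) ^ n * (((Q : ℕ+) : ℕ) : ℝ) ^ (n - T.card) * (((Q : ℕ+) : ℕ) : ℝ) ^ T.card
      = (((Q : ℕ+) : ℕ) : ℝ) ^ (2 * n) := by
    rw [mul_assoc, ← pow_add, Nat.sub_add_cancel hT, ← pow_add, two_mul]
  rw [div_eq_div_iff (pow_ne_zero _ hQ.ne') (pow_ne_zero _ hQ.ne')]
  calc (pairsCountT (Q : ℕ) T : ℝ) * (((Q : ℕ+) : ℕ) : ℝ) ^ (T.card + 1)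
      = (((Q : ℕ+) : ℕ) : ℝ) * (pairsCountT (Q : ℕ) T : ℝ) * (((Q : ℕ+) : ℕ) : ℝ) ^ T.card := by
        rw [pow_succ]; ring
    _ = (∑ σ : ZQ Q, ((Nat.card {x : ZQ Q // σ * x = 0} : ℝ)) ^ T.card)
          * ((((Q : ℕ+) : ℕ) : ℝ) ^ n * (((Q : ℕ+) : ℕ) : ℝ) ^ (n - T.card)
              * (((Q : ℕ+) : ℕ) : ℝ) ^ T.card) := by
        rw [hreal]; ring
    _ = (∑ σ : ZQ Q, ((Nat.card {x : ZQ Q // σ * x = 0} : ℝ)) ^ T.card)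
          * (((Q : ℕ+) : ℕ) : ℝ) ^ (2 * n) := by rw [hpow]

/-- **Part 1 = Part 2**: the Step-8 read-out constant `pairsCountT(Q,T)/Q^{2n}` of (S)/(T)/(U)/(V) is
T13's datum value `V(Q, #T) = datumValue Q ι` for every index type `ι` with `#ι = #T`.
[cite: ChenQuantumLattice2024, §3.5.8–§3.5.9 pp. 34–37] -/
theorem pairsCountT_div_eq_datumValue (T : Finset (Fin n)) (ι : Type*) [Fintype ι] [DecidableEq ι]
    (hι : Fintype.card ι = T.card) :
    (pairsCountT (Q : ℕ) T : ℝ) / (((Q : ℕ+) : ℕ) : ℝ) ^ (2 * n) = datumValue Q ι := by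
  rw [pairsCountT_div_eq_sum_pow, datumValue_eq_sum_pow, hι]

/-- `pairsCountT(Q,T)/Q^{2n} = datumValue Q (Fin #T)`. [cite: ChenQuantumLattice2024, §3.5.8–§3.5.9 pp. 34–37] -/
theorem pairsCountT_div_eq_datumValue_fin (T : Finset (Fin n)) :
    (pairsCountT (Q : ℕ) T : ℝ) / (((Q : ℕ+) : ℕ) : ℝ) ^ (2 * n) = datumValue Q (Fin T.card) :=
  pairsCountT_div_eq_datumValue Q T (Fin T.card) (Fintype.card_fin _)

/-- `pairsCountT(Q,T)/Q^{2n} = datumValue Q T` (`T` as an index type). [cite: ChenQuantumLattice2024, §3.5.8–§3.5.9 pp. 34–37] -/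
theorem pairsCountT_div_eq_datumValue_coe (T : Finset (Fin n)) :
    (pairsCountT (Q : ℕ) T : ℝ) / (((Q : ℕ+) : ℕ) : ℝ) ^ (2 * n) = datumValue Q T :=
  pairsCountT_div_eq_datumValue Q T T (Fintype.card_coe T)

end Counting

end Literature.Computability.Cryptography.Chen2024

/-! ### 2. Chen's Step 8: the read-out value on the class is `V(Q, #T_U)` -/

namespace Literature.Computability.Cryptography.Chen2024.Shape

open scoped BigOperators ComplexOrder
open Matrix

variable (S : Shape)

/-- Part 1's read-out constant for Chen's parameters is Part 2's datum value `V(Q, #T)`.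
[cite: ChenQuantumLattice2024, §3.5.8–§3.5.9 pp. 34–37] -/
theorem readoutConst_eq_datumValue (T : Finset (Fin S.n)) :
    (pairsCountT (S.Q : ℕ) T : ℝ) / ((S.Q : ℕ) : ℝ) ^ (2 * S.n) = datumValue S.Q (Fin T.card) :=
  pairsCountT_div_eq_datumValue_fin S.Q T

/-- **The minimax read-out value of the Step-9 datum from the Step-8 register is `V(Q, #T_U)·⟨φ|φ⟩`**
— (U)'s `step9Needs_readout_value_class` with its constant identified as T13's datum value:
(i) every POVM + decoder on `|φ7.d⟩` fails on some instance of `InClass U` at `V(Q, #T_U)·⟨φ|φ⟩`;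
(ii) the class measurement attains exactly `V(Q, #T_U)·⟨φ|φ⟩` on every instance
(`T_U = {t : t+1 ∈ U}`; `V(Q, m) = Q^{-(m+1)}·Σ_σ gcd(Q,σ)^m`, `= 1/Q + (1 − 1/Q)/Q^m` for prime `Q`).
[cite: ChenQuantumLattice2024, §3.5.8–§3.5.9 pp. 34–37] -/
theorem step9Needs_readout_value_class_datumValue (h : S.Admissible) (U : Finset (Fin (S.n + 1))) :
    (∀ {κ : Type*} [Fintype κ] [DecidableEq κ] (E : POVM (Fin (S.n + 1) → ZMod S.M) κ) (dec : κ → ZMod S.N),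
        ∃ b₂ v₂, S.InClass U b₂ v₂ ∧
          ∑ k ∈ Finset.univ.filter (fun k => dec k = (S.inst b₂ v₂).step9Needs),
              (E.weight (S.inst b₂ v₂).phi7d k).re
            ≤ datumValue S.Q (Fin (S.tailSet U).card)
                * (star (S.inst b₂ v₂).phi7d ⬝ᵥ (S.inst b₂ v₂).phi7d).re) ∧
      ∀ b₂ v₂ : Fin (S.n + 1) → ℤ, S.InClass U b₂ v₂ →
        ∑ k ∈ Finset.univ.filter (fun k => S.classDec (S.tailSet U) k = (S.inst b₂ v₂).step9Needs),
            ((S.classPOVM h).weight (S.inst b₂ v₂).phi7d k).re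
          = datumValue S.Q (Fin (S.tailSet U).card)
              * (star (S.inst b₂ v₂).phi7d ⬝ᵥ (S.inst b₂ v₂).phi7d).re := by
  rw [← S.readoutConst_eq_datumValue (S.tailSet U)]
  exact S.step9Needs_readout_value_class h U

end Literature.Computability.Cryptography.Chen2024.Shape
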